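import Literature.NumberTheory.ConnesConsani2021.JumpFormula
import Literature.NumberTheory.ConnesConsani2021.ArchimedeanCorollary
import Literature.NumberTheory.ConnesConsani2021.WeilPropertyP
import Literature.NumberTheory.LFunctions.WeilBochnerRepresentation
import Literature.NumberTheory.LFunctions.YoshidaWindowSpaces
import HarnessLib

/-!
# Connes–Consani 2021, §3 (remainder): positive definite test functions, the Boas–Kac square root,
# positive functionals, Prop. 3.5, Cor. 3.8 / Rem. 3.9 — STATEMENTS AS PRINTED, PROVED where δ-free

LABEL (line 1): RH-FREE corpus statements about test functions on `ℝ₊*`; nothing in this file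
mentions `ζ`-zeros or bears on the truth of RH.  The one printed NUMERICAL input of the section
(Cor. 3.8: "one verifies numerically that `∫₀ˢ Q₊δ(ν(x)) dx ≤ 1` for `s = 0.097542`", and Rem. 3.9 (i):
`s = 0.14043`) is NUMERICAL-IN-PRINT and enters below only as an explicit HYPOTHESIS (`hnum`), never
as a theorem and never re-computed (cell rule: 0 kit).

A. Connes, C. Consani, *Weil positivity and trace formula, the archimedean place*, Selecta Math.
(N.S.) 27 (2021), Paper No. 77 = arXiv:2006.13771 [bib: `ConnesConsani2021`], §3 "Support and boundary
conditions".  NUMBERING: Selecta numbers statements consecutively within sections (`pub-rhdoor/CC-MAP.md`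
§3 dictionary: Prop 13 = Prop 3.2, Prop 16 = Prop 3.5, Thm 17 = Thm 3.6); the arXiv text extraction shows
the running count.  Hence Def 12 = Def 3.1, Prop 13 = Prop 3.2, Lemma 14 = Lemma 3.3, Def 15 = Def 3.4,
Prop 16 = Prop 3.5, Thm 17 = Thm 3.6, Rem 18 = Rem 3.7, Cor 19 = Cor 3.8, Rem 20 = Rem 3.9 (locators
below: arXiv chunk `pNNNN:Lnn` of `lit read arxiv:2006.13771`).  (The tree file
`VanishingIdealReduction.lean` labels arXiv Lemma 14 "Lemma 3.1"; by the consecutive count it is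
Lemma 3.3 — same statement, cited here by its decl names.)

Vocabulary (no parallel vocabulary is opened): the additive avatar `f = F ∘ exp` of a test function
`F ∈ C_c^∞(ℝ₊*)` (`IsWeilTest f`, `WeilExplicit.lean`); CC's Fourier transform
`F̂(s) = ∫ F(u) u^{-is} d*u` is `mulFourier f s` (`ArchimedeanSoninTrace.lean`); CC's convolution and
involution are `weilConv`, `weilReflect`; CC's `C_c^∞(I)` for the symmetric interval `I = [e^{-a}, e^{a}]`
("the subspace of functions whose support is contained in `I`", p. 12, p0012:L76) is the tree's
`Literature.NumberTheory.LFunctions.Yoshida1992.C a = {φ | IsWeilTest φ ∧ tsupport φ ⊆ [−a, a]}`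
(`YoshidaWindowSpaces.lean`); CC's `Q = −(ρ∂_ρ)² + ¼` is `opQ` and their functionals
`D(f) = ∫ f(ρ⁻¹)δ(ρ)d*ρ`, `D₊(f) = ∫ f(x) δ(ν(x)) dx` are `evenFunctional G` with `G(x) = δ(eˣ)` on
`x ≥ 0` (`JumpFormula.lean`, generic in the even function — CC's `δ` itself, §2 Def. 2.? / eq. (25), is
the object of the §2 file `SchwartzKernels.lean`, not of this one).

## What is printed and what is here

* **Def. 3.1** (= Def 12, p0012:L5): "Let `G` be a locally compact abelian group and `f ∈ L¹(G, dg)`.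
  We say that `f` is positive definite when its Fourier transform is pointwise positive, `f̂(t) ≥ 0`,
  `t ∈ Ĝ`."  Typed for the only group used in the paper, `G = ℝ₊* ≅ ℝ` (additive avatar):
  `IsPositiveDefinite f := Integrable f ∧ ∀ t : ℝ, f̂(t) ∈ ℝ_{≥0}` with `f̂ = mulFourier f`; dictionary
  with Mathlib's `𝓕` (`isPositiveDefinite_iff_fourierIntegral`) and with the tree's critical-line
  transform `ĝ(½ + it)` (`isPositiveDefinite_iff_weilMellin`).  TODO(general form): LCA groups.
* **Prop. 3.2** (= Prop 13, p0012:L10–L19; [BK] = Boas–Kac 1945 Lemma 5.1): "Let `f ∈ C_c^∞(ℝ)` have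
  support in `[−A, A]` (`A > 0`).  TFAE: (1) `f̂` is pointwise positive; (2) there exists
  `g ∈ C_c^∞(ℝ)` with support in `[−A/2, A/2]` such that `f = g ∗ g*`", and its multiplicative form
  (p0012:L21: a positive definite `f ∈ C_c^∞(ℝ₊*)` supported in `I = [A⁻¹, A]` has a convolution square
  root supported in `√I`).  PROVED (`isPositiveDefinite_iff_exists_weilConv_weilReflect`): (1) ⇒ (2) is
  the tree's Boas–Kac/Kreĭn factorisation
  `Literature.NumberTheory.LFunctions.WeilBochner.exists_sq_eq_of_weilMellin_nonneg`
  (`Literature.Analysis.Fourier.BoasKacNonneg`), (2) ⇒ (1) is `(g ∗ g*)^(t) = |ĝ(t)|²`.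
* **Lemma 3.3** (= Lemma 14): (ii), (iii) are the tree's `isWeilTest_opQ`, `tsupport_opQ_subset`,
  `mulFourier_opQ_I_half`, `mulFourier_opQ_neg_I_half`, `exists_opQ_eq` (`VanishingIdealReduction.lean`,
  cited, not restated).  Completed here: **(i)** "the vanishing conditions (3.2)
  [`f̂(± i/2) = 0`] define an ideal `𝒥` in the convolution algebra" — `vanishingIdeal`,
  `weilConv_mem_vanishingIdeal_left/right` (via `mulFourier_weilConv`: "`∫ f(ρ)ρ^z d*ρ` defines a
  character of the convolution algebra", proof of (i), p0012:L52); **(iv)** "`f` [= `Qg`] is positive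
  definite iff `g` is" — `isPositiveDefinite_opQ_iff` (from the tree's `mulFourier_opQ`:
  `(Qg)^(t) = (¼ + t²) ĝ(t)`).
* **Def. 3.4** (= Def 15, p0013:L1–L2): "Let `E ⊂ C_c^∞(ℝ₊*)` be a subspace and `ψ` a linear form on
  `E`.  Then `ψ` is said to be positive if `ψ(f) ≥ 0` for any positive definite `f ∈ E`" —
  `IsPositiveOn ψ E` (real parts, the convention of `WeilPositivityOn` / `weilPropertyP`); CC's
  "`φ ≤ 0` on `E`" is `IsPositiveOn (-φ) E`.
* **Prop. 3.5** (= Prop 16, p0013:L6–L9): "Let `ψ` be a functional on `C_c^∞(ℝ₊*)` and `I` a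
  symmetric interval.  Then the restriction of `ψ` to `C_c^∞(I) ∩ 𝒥` is positive iff the functional
  `ψ ∘ Q` is positive on `C_c^∞(I)`."  PROVED as printed (`isPositiveOn_inter_vanishingIdeal_iff`), and
  the displayed consequence (3.x) (p0013:L18–L21) "`D∘Q ≤ 0` on `C_c^∞(I)` ⇒ `W_∞ ≥ 0` on
  `C_c^∞(I) ∩ 𝒥`" in its abstract form, with the positivity of `L = D + W_∞` (Cor. 2.3, §2 file) as
  hypothesis — `isPositiveOn_inter_vanishingIdeal_of_add`.
* **Cor. 3.8** (= Cor 19, p0014:L13–L21; NUMERICAL-IN-PRINT): "One has `D∘Q ≤ 0` on `C_c^∞(I)`,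
  where `I = [u⁻¹, u]`, `u = 1.10246`.  Proof. … When `f ∈ C_c^∞(ℝ)` is positive definite …
  `|f(x)| ≤ f(0)` for all `x`.  It follows that the functional `D₊∘Q₊` is [negative] on `C_c^∞(I)`
  where `I = [−s, s]`, as long as `∫₀ˢ Q₊δ(ν(x)) dx ≤ 1`.  One verifies numerically that this holds for
  `s = 0.097542`, which gives `eˢ ≃ u`."  Here: the bound `|f(x)| ≤ f(0)` PROVED
  (`IsPositiveDefinite.norm_le`), the mechanism PROVED for the generic even function
  (`isPositiveOn_neg_evenFunctional_opQ`), and the printed corollary as the instance `s = 0.097542`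
  with the numerical verification as hypothesis `hnum` (`cor_3_8_of_numericalInput`).  The integral is
  typed with `‖Q₊δ‖` (what the argument `|f| ≤ f(0)` uses; for CC's `δ` the integrand is positive on
  `[0, s]`, where the two agree).
* **Rem. 3.9** (= Rem 20, p0014:L23–L50): (i) the improvement `s = 0.14043`, `u = 1.15077` from the
  Boas–Kac pointwise bound "[BK] Theorem 2, typo corrected in [BKe]:
  `|f(x)| ≤ f(0) cos(π/(⌈s/x⌉ + 1))` for any positive definite `f` with support in `[−s, s]`" —
  mechanism PROVED with the majorant as hypothesis schema (`isPositiveOn_neg_evenFunctional_opQ_of_majorant`,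
  `rem_3_9_i_of_numericalInput`; the Boas–Kac bound itself — Duke Math. J. 12 (1945) Thm 2, restated
  in Kolountzakis–Révész, Canad. J. Math. 58 (2006) Cor. 1 — is an INPUT hypothesis `hBK` here, not a
  tree fact); (ii) "`D∘Q` is not negative on `[2⁻¹, 2]`" (limit value `2.98699`, numerical, about CC's
  specific `δ`) is RECORDED here, not typed (it needs `δ`; NUMERICAL-IN-PRINT).
* **Superseded in range by the tree** (lead's note, NODES `CC21:Cor19`): the CONSEQUENCE of Cor. 3.8 /
  Rem. 3.9 (i) via (3.x), "`W_∞ ≥ 0` on `C_c^∞(I) ∩ 𝒥`" for `I = [u⁻¹, u]`, `u = 1.10246` resp.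
  `1.15077`, holds for EVERY symmetric `I = [e^{−c}, e^{c}]` with `0 < c ≤ log 2` by Yoshida's rung
  `WeilPositivityOn ((log 2)/2)` (`weilPositivityOn_log_two_half_holds`) and the explicit formula
  (no prime below `log 2`, no pole on `𝒥`): `isPositiveOn_archW_inter_vanishingIdeal` (PROVED).  Full
  Weil positivity — the quantity the programme is after — is in the tree up to `g`-support `(log 3)/2`
  (`Literature.NumberTheory.LFunctions.weilPositivityOn_log_three_half`, kernel certificate), i.e. for
  `f = g ∗ g*` supported in `[3⁻¹, 3] ⊋ [u⁻¹, u]` (`isPositiveOn_weilFunctional_log_three`); the dictionary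
  "Def. 3.4-positivity of `W` on `C_c^∞([n⁻¹, n]) ∩ 𝒥` ⇒ Connes's `P(n)`" is
  `weilPropertyP_of_isPositiveOn_weilFunctional`.

Deliberately NOT here: CC's function `δ` and the functional `D` as concrete objects (§2), Theorem 3.6
/ Remark 3.7 (tree: `WindowOperatorCompact.lean`, `JumpFormula.lean`), any numerics, any RH statement.
-/

noncomputable section

open MeasureTheory Set Complex Filter FourierTransform
open scoped Real ComplexConjugate

namespace Literature.NumberTheory.ConnesConsani2021

open Literature.NumberTheory.LFunctions

variable {f g h : ℝ → ℂ} {a : ℝ}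

/-! ## Bookkeeping -/

/-- A test function (`C_c^∞`) is `C²`. [folklore] -/
private theorem contDiff_two_of_isWeilTest' (hf : IsWeilTest f) : ContDiff ℝ 2 f :=
  hf.1.of_le (WithTop.coe_le_coe.2 le_top)

/-- `Q₊G = −G″ + G/4` is continuous for `G ∈ C²`. [folklore] -/
private theorem continuous_opQ' {G : ℝ → ℂ} (hG : ContDiff ℝ 2 G) : Continuous (opQ G) := by
  have h1 : ContDiff ℝ 1 (deriv G) := by
    rw [← one_add_one_eq_two] at hG
    exact hG.deriv'
  have h2 : Continuous (deriv (deriv G)) := h1.continuous_deriv le_rfl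
  show Continuous fun t ↦ -deriv (deriv G) t + (1 / 4 : ℂ) * G t
  exact h2.neg.add (continuous_const.mul hG.continuous)

/-- A test function is integrable. [folklore] -/
private theorem integrable_of_isWeilTest (hf : IsWeilTest f) : Integrable f :=
  hf.1.continuous.integrable_of_hasCompactSupport hf.2

/-- A complex number with nonnegative real part and zero imaginary part is the real number `‖z‖`. [folklore] -/
private theorem eq_coe_norm_of_nonneg {z : ℂ} (h : 0 ≤ z.re ∧ z.im = 0) : z = (‖z‖ : ℂ) := by
  have hz : z = (z.re : ℂ) := Complex.ext (by simp) (by simp [h.2])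
  rw [hz, Complex.norm_real, Real.norm_eq_abs, abs_of_nonneg h.1]

/-! ## CC's Fourier transform at real points: dictionary -/

/-- RH-FREE. At a real point `t`, CC's `f̂(t) = ∫ f(x) e^{−itx} dx` is the tree's critical-line value
`weilMellin f (½ − it)`. [cite: ConnesConsani2021, App. A eq. (79) p. 30] -/
theorem mulFourier_ofReal (f : ℝ → ℂ) (t : ℝ) :
    mulFourier f t = weilMellin f (1 / 2 + ((-t : ℝ) : ℂ) * I) := by
  rw [mulFourier_eq_weilMellin]
  congr 1
  push_cast
  ring

/-- RH-FREE. `f̂(−t) = weilMellin f (½ + it)` for real `t`. [cite: ConnesConsani2021, App. A eq. (79) p. 30] -/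
theorem mulFourier_neg_ofReal (f : ℝ → ℂ) (t : ℝ) :
    mulFourier f ((-t : ℝ) : ℂ) = weilMellin f (1 / 2 + t * I) := by
  rw [mulFourier_ofReal, neg_neg]

/-- RH-FREE. CC's `f̂` at a real point versus Mathlib's Fourier integral: `f̂(t) = 𝓕 f (t/2π)`
(`𝓕 f ξ = ∫ f(x) e^{−2πixξ} dx`). [cite: ConnesConsani2021, eq. (13) p. 7 and App. A p. 30] -/
theorem mulFourier_ofReal_eq_fourierIntegral (f : ℝ → ℂ) (t : ℝ) :
    mulFourier f t = 𝓕 f (t / (2 * π)) := by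
  have h := fourier_weilKernel f (1 / 2) (t / (2 * π))
  have e : (fun x : ℝ ↦ f x * cexp ((((1 / 2 : ℝ) : ℂ) - 1 / 2) * x)) = f := by
    funext x; push_cast; simp
  rw [e] at h
  have harg : (1 / 2 : ℂ) + ((-t : ℝ) : ℂ) * I =
      ((1 / 2 : ℝ) : ℂ) + ((-(2 * π * (t / (2 * π))) : ℝ) : ℂ) * I := by
    have ht : 2 * π * (t / (2 * π)) = t := by field_simp
    rw [ht]; push_cast; ring
  rw [h, mulFourier_ofReal, harg]

/-- RH-FREE. **"For any complex power `z` the functional `∫ f(ρ)ρ^z d*ρ` defines a character of the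
convolution algebra `C_c^∞(ℝ₊*)`"** (proof of Lemma 3.3 (i), p. 12; App. A p. 30): for test functions,
`(f ∗ h)^(s) = f̂(s) ĥ(s)` for every complex `s` (the tree's `weilMellin_weilConv_holds`).
[cite: ConnesConsani2021, Lemma 3.3 (i) §3 p. 12 (proof, arXiv Lemma 14 p0012:L52); App. A p. 30] -/
theorem mulFourier_weilConv (hf : IsWeilTest f) (hh : IsWeilTest h) (s : ℂ) :
    mulFourier (weilConv f h) s = mulFourier f s * mulFourier h s := by
  simp only [mulFourier_eq_weilMellin]
  exact weilMellin_weilConv_holds hf.1.continuous hf.2 hh.1.continuous hh.2 _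

/-- RH-FREE. `(g ∗ g*)^(t) = |ĝ(t)|²` at real `t` (App. A: the transform turns "the involution into the
pointwise complex conjugation, `s ∈ ℝ`"; tree: `weilMellin_weilConv_weilReflect_half`).
[cite: ConnesConsani2021, App. A p. 30; Prop. 3.2 §3 p. 12 (proof: "`f̂(t) = |ĝ(t)|²`")] -/
theorem mulFourier_weilConv_weilReflect_ofReal (hg : IsWeilTest g) (t : ℝ) :
    mulFourier (weilConv g (weilReflect g)) t = ((‖mulFourier g t‖ ^ 2 : ℝ) : ℂ) := by
  rw [mulFourier_ofReal, weilMellin_weilConv_weilReflect_half hg, mulFourier_ofReal]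

/-! ## Definition 3.1: positive definite functions -/

/-- RH-FREE. **Connes–Consani 2021, Definition 3.1** (= arXiv Def. 12, p. 12, p0012:L5–L6): "Let `G` be a locally
compact abelian group and `f ∈ L¹(G, dg)`.  We say that `f` is *positive definite* when its Fourier
transform is pointwise positive, `f̂(t) ≥ 0`, `t ∈ Ĝ`."  Typed for `G = ℝ₊* ≅ ℝ` (the case of the
paper), additive avatar, with CC's transform `f̂ = mulFourier f`: `f` is integrable and `f̂(t)` is a
nonnegative real for every real `t`.  (Dictionary with Mathlib's `𝓕` and the tree's `weilMellin`:
`isPositiveDefinite_iff_fourierIntegral`, `isPositiveDefinite_iff_weilMellin`.)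
TODO(general form): arbitrary locally compact abelian `G`.
[cite: ConnesConsani2021, Def. 3.1 §3 p. 12 (arXiv Def. 12, p0012:L5)] -/
def IsPositiveDefinite (f : ℝ → ℂ) : Prop :=
  Integrable f ∧ ∀ t : ℝ, 0 ≤ (mulFourier f t).re ∧ (mulFourier f t).im = 0

/-- RH-FREE. Definition 3.1 through the tree's critical-line transform: `f` is positive definite iff `f ∈ L¹` and
`ĝ(½ + it) ∈ ℝ_{≥0}` for all real `t` (`f̂(−t) = weilMellin f (½ + it)`).
[cite: ConnesConsani2021, Def. 3.1 §3 p. 12] -/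
theorem isPositiveDefinite_iff_weilMellin :
    IsPositiveDefinite f ↔ Integrable f ∧
      ∀ t : ℝ, 0 ≤ (weilMellin f (1 / 2 + t * I)).re ∧ (weilMellin f (1 / 2 + t * I)).im = 0 := by
  refine and_congr_right fun _ ↦ ⟨fun h t ↦ ?_, fun h t ↦ ?_⟩
  · rw [← mulFourier_neg_ofReal]; exact h (-t)
  · have := h (-t)
    rwa [← mulFourier_neg_ofReal, neg_neg] at this

/-- RH-FREE. Definition 3.1 through Mathlib's Fourier integral: `f` is positive definite iff `f ∈ L¹` and
`𝓕 f ξ ∈ ℝ_{≥0}` for all real `ξ`. [cite: ConnesConsani2021, Def. 3.1 §3 p. 12; eq. (13) p. 7] -/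
theorem isPositiveDefinite_iff_fourierIntegral :
    IsPositiveDefinite f ↔ Integrable f ∧ ∀ ξ : ℝ, 0 ≤ (𝓕 f ξ).re ∧ (𝓕 f ξ).im = 0 := by
  refine and_congr_right fun _ ↦ ⟨fun h ξ ↦ ?_, fun h t ↦ ?_⟩
  · have := h (2 * π * ξ)
    rwa [mulFourier_ofReal_eq_fourierIntegral, mul_div_cancel_left₀ _ (by positivity)] at this
  · rw [mulFourier_ofReal_eq_fourierIntegral]; exact h _

/-- RH-FREE. **Prop. 3.2, (2) ⇒ (1)**: a hermitian square `g ∗ g*` of a test function is positive definite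
("the equality `f̂(t) = |ĝ(t)|²` shows that `f` is positive definite", p0012:L19).
[cite: ConnesConsani2021, Prop. 3.2 §3 p. 12 (arXiv Prop. 13, p0012:L19)] -/
theorem isPositiveDefinite_weilConv_weilReflect (hg : IsWeilTest g) :
    IsPositiveDefinite (weilConv g (weilReflect g)) := by
  refine ⟨integrable_of_isWeilTest (hg.weilConv hg.weilReflect), fun t ↦ ?_⟩
  rw [mulFourier_weilConv_weilReflect_ofReal hg, Complex.ofReal_re, Complex.ofReal_im]
  exact ⟨by positivity, rfl⟩

/-- Fourier inversion for a test function on the critical line: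
`f(x) = (2π)⁻¹ ∫ ĝ(½ + iy) e^{−iyx} dy` (tree: `weilMellin_inversion` at `c = ½`). [folklore] -/
private theorem apply_eq_inversion (hf : IsWeilTest f) (x : ℝ) :
    f x = (1 / (2 * π) : ℂ) * ∫ y : ℝ, weilMellin f (1 / 2 + y * I) * cexp (-(y * I) * x) := by
  have h := weilMellin_inversion hf (1 / 2) x
  push_cast at h
  rw [h]
  simp only [sub_self, zero_mul, Complex.exp_zero, mul_one]
  have hπ : (2 * π : ℂ) ≠ 0 := by exact_mod_cast Real.two_pi_pos.ne'
  field_simp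

/-- RH-FREE. For a positive definite test function, `f(0) = (2π)⁻¹ ∫ f̂ ≥ 0` is real: precisely
`f(0) = (2π)⁻¹ ∫ ‖ĝ(½ + iy)‖ dy` (Fourier inversion; the first step of "`|f(x)| ≤ f(0)`" in the proof of
Cor. 3.8). [cite: ConnesConsani2021, Cor. 3.8 §3 p. 14 (proof, arXiv Cor. 19, p0014:L16)] -/
theorem IsPositiveDefinite.apply_zero_eq (hf : IsWeilTest f) (hpd : IsPositiveDefinite f) :
    f 0 = (((1 / (2 * π)) * ∫ y : ℝ, ‖weilMellin f (1 / 2 + y * I)‖ : ℝ) : ℂ) := by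
  rw [apply_eq_inversion hf 0]
  push_cast
  congr 1
  rw [← integral_complex_ofReal]
  refine integral_congr_ae (Eventually.of_forall fun y ↦ ?_)
  simp only [mul_zero, Complex.exp_zero, mul_one]
  exact eq_coe_norm_of_nonneg ((isPositiveDefinite_iff_weilMellin.1 hpd).2 y)

/-- RH-FREE. **"`|f(x)| ≤ f(0)` for all `x`"** for a positive definite test function (proof of Cor. 3.8,
p0014:L16: "when `f` is positive definite the matrix `f(x_i − x_j)` is a positive matrix … this implies
in particular that `|f(x)| ≤ f(0)`"; here from Fourier inversion, `|∫ f̂ e^{−iyx}| ≤ ∫ f̂ = 2π f(0)`).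
[cite: ConnesConsani2021, Cor. 3.8 §3 p. 14 (proof, arXiv Cor. 19, p0014:L16)] -/
theorem IsPositiveDefinite.norm_le (hf : IsWeilTest f) (hpd : IsPositiveDefinite f) (x : ℝ) :
    ‖f x‖ ≤ (f 0).re := by
  rw [hpd.apply_zero_eq hf, Complex.ofReal_re, apply_eq_inversion hf x, norm_mul]
  have h1 : ‖(1 / (2 * π) : ℂ)‖ = 1 / (2 * π) := by
    rw [show (1 / (2 * π) : ℂ) = ((1 / (2 * π) : ℝ) : ℂ) by push_cast; rfl, Complex.norm_real,
      Real.norm_eq_abs, abs_of_nonneg (by positivity)]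
  rw [h1]
  refine mul_le_mul_of_nonneg_left ((norm_integral_le_integral_norm _).trans (le_of_eq ?_))
    (by positivity)
  refine integral_congr_ae (Eventually.of_forall fun y ↦ ?_)
  simp only [norm_mul]
  rw [show -((y : ℂ) * I) * (x : ℂ) = ((-(y * x) : ℝ) : ℂ) * I by push_cast; ring,
    Complex.norm_exp_ofReal_mul_I, mul_one]

/-- RH-FREE. For a positive definite test function, `f(0)` is a nonnegative real. [cite: ConnesConsani2021, Cor. 3.8 §3 p. 14 (proof)] -/
theorem IsPositiveDefinite.apply_zero_nonneg (hf : IsWeilTest f) (hpd : IsPositiveDefinite f) :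
    0 ≤ (f 0).re ∧ (f 0).im = 0 := by
  rw [hpd.apply_zero_eq hf, Complex.ofReal_re, Complex.ofReal_im]
  exact ⟨by positivity, rfl⟩

/-- RH-FREE. A positive definite test function is hermitian, `f(−x) = conj f(x)`, i.e. `f* = f` (App. A: real
transform ⇔ involution-invariance). [cite: ConnesConsani2021, App. A p. 30] -/
theorem IsPositiveDefinite.weilReflect_eq (hf : IsWeilTest f) (hpd : IsPositiveDefinite f) :
    weilReflect f = f := by
  funext x
  simp only [weilReflect]
  rw [apply_eq_inversion hf (-x), apply_eq_inversion hf x, map_mul, ← integral_conj]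
  have hc : conj (1 / (2 * π) : ℂ) = 1 / (2 * π) := by
    rw [map_div₀, map_one, map_mul, map_ofNat, Complex.conj_ofReal]
  rw [hc]
  congr 1
  refine integral_congr_ae (Eventually.of_forall fun y ↦ ?_)
  have hreal := eq_coe_norm_of_nonneg ((isPositiveDefinite_iff_weilMellin.1 hpd).2 y)
  dsimp only
  rw [map_mul, hreal, Complex.conj_ofReal, ← Complex.exp_conj]
  congr 2
  simp only [map_mul, map_neg, Complex.conj_ofReal, Complex.conj_I]
  push_cast
  ring

/-! ## Proposition 3.2 (Boas–Kac): convolution square roots -/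

/-- RH-FREE. **Connes–Consani 2021, Proposition 3.2** (= arXiv Prop. 13, p. 12, p0012:L10–L19; "[BK] Lemma 5.1 and
[EGR]").  "Let `f ∈ C_c^∞(ℝ)` have support in the interval `[−A, A]` (`A > 0`).  The following
conditions are equivalent: (1) the Fourier transform `f̂` is pointwise positive; (2) there exists
`g ∈ C_c^∞(ℝ)` with support in `[−A/2, A/2]` such that `f = g ∗ g*`."  Multiplicative reading
(p0012:L21): "for any positive definite `f ∈ C_c^∞(ℝ₊*)` with support in a symmetric interval
`I = [A⁻¹, A]`, a convolution square root with support in `√I = [A^{−1/2}, A^{1/2}]`" (additive window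
`[−a, a] ↔ [e^{−a}, e^{a}]`).  PROVED: (1) ⇒ (2) is the tree's Boas–Kac/Kreĭn factorisation
`WeilBochner.exists_sq_eq_of_weilMellin_nonneg` (Boas–Kac 1945 Thm 1 with the smooth upgrade,
`Literature.Analysis.Fourier.BoasKacNonneg`); (2) ⇒ (1) is `isPositiveDefinite_weilConv_weilReflect`.
[cite: ConnesConsani2021, Prop. 3.2 §3 p. 12 (arXiv Prop. 13, p0012:L10–L19)] -/
theorem isPositiveDefinite_iff_exists_weilConv_weilReflect {A : ℝ} (hA : 0 < A) (hf : IsWeilTest f)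
    (hfs : tsupport f ⊆ Icc (-A) A) :
    IsPositiveDefinite f ↔
      ∃ g : ℝ → ℂ, IsWeilTest g ∧ tsupport g ⊆ Icc (-(A / 2)) (A / 2) ∧
        weilConv g (weilReflect g) = f := by
  constructor
  · intro hpd
    have hfs' : tsupport f ⊆ Icc (-(2 * (A / 2))) (2 * (A / 2)) := by
      convert hfs using 2 <;> ring
    exact WeilBochner.exists_sq_eq_of_weilMellin_nonneg (half_pos hA) hf hfs'
      (isPositiveDefinite_iff_weilMellin.1 hpd).2
  · rintro ⟨g, hg, -, rfl⟩
    exact isPositiveDefinite_weilConv_weilReflect hg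

/-! ## Lemma 3.3 (i) and (iv): the ideal `𝒥` of the vanishing conditions -/

/-- RH-FREE. **The vanishing conditions (3.2)** (p. 12, p0012:L28–L31: "we assume the vanishing conditions
`∫ f(ρ)ρ^{±1/2} d*ρ = 0` to isolate on the left hand side of the explicit formula the contribution of
the zeros"), i.e. `f̂(i/2) = f̂(−i/2) = 0` (Intro p. 5; tree normalisation `weilMellin f 1 = weilMellin f 0 = 0`,
`mulFourier_I_half`, `mulFourier_neg_I_half`): the set `𝒥` of Lemma 3.3 (i).  Its intersection with
`C_c^∞(I)` is CC's `C_c^∞(I) ∩ 𝒥` (Prop. 3.5); the tree's `weilPropertyP` writes the same two conditions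
inline.  As in print, `𝒥 ⊂ C_c^∞(ℝ₊*)`: membership includes being a test function (`IsWeilTest`).
[cite: ConnesConsani2021, eq. (3.2) §3 p. 12 (p0012:L29–L31); Lemma 3.3 (i)] -/
def vanishingIdeal : Set (ℝ → ℂ) :=
  {f | IsWeilTest f ∧ mulFourier f (I / 2) = 0 ∧ mulFourier f (-(I / 2)) = 0}

/-- RH-FREE. Membership in `𝒥`. [cite: ConnesConsani2021, eq. (3.2) §3 p. 12] -/
@[simp] theorem mem_vanishingIdeal :
    f ∈ vanishingIdeal ↔ IsWeilTest f ∧ mulFourier f (I / 2) = 0 ∧ mulFourier f (-(I / 2)) = 0 :=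
  Iff.rfl

/-- RH-FREE. `𝒥` in the tree's Mellin normalisation: test functions with `ĝ(1) = 0 ∧ ĝ(0) = 0`
(pole-free test functions). [cite: ConnesConsani2021, Intro p. 5; App. A p. 30] -/
theorem mem_vanishingIdeal_iff_weilMellin :
    f ∈ vanishingIdeal ↔ IsWeilTest f ∧ weilMellin f 1 = 0 ∧ weilMellin f 0 = 0 := by
  rw [mem_vanishingIdeal, mulFourier_I_half, mulFourier_neg_I_half]

/-- RH-FREE. **Lemma 3.3 (i)** (= arXiv Lemma 14 (i), p0012:L44, proof L52): "The vanishing conditions (3.2)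
define an ideal `𝒥` in the convolution algebra `C_c^∞(ℝ₊*)`" — "the intersection of the kernels of two
characters, an ideal": `h ∗ f ∈ 𝒥` for `f ∈ 𝒥` and any test function `h`.
[cite: ConnesConsani2021, Lemma 3.3 (i) §3 p. 12 (arXiv Lemma 14 (i), p0012:L44, L52)] -/
theorem weilConv_mem_vanishingIdeal_left (hh : IsWeilTest h) (hfJ : f ∈ vanishingIdeal) :
    weilConv h f ∈ vanishingIdeal := by
  rw [mem_vanishingIdeal] at hfJ ⊢
  obtain ⟨hf, h1, h2⟩ := hfJ
  rw [mulFourier_weilConv hh hf, mulFourier_weilConv hh hf, h1, h2, mul_zero, mul_zero]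
  exact ⟨hh.weilConv hf, rfl, rfl⟩

/-- RH-FREE. **Lemma 3.3 (i)**, right form: `f ∗ h ∈ 𝒥` for `f ∈ 𝒥` and any test function `h`.
[cite: ConnesConsani2021, Lemma 3.3 (i) §3 p. 12 (arXiv Lemma 14 (i), p0012:L44, L52)] -/
theorem weilConv_mem_vanishingIdeal_right (hh : IsWeilTest h) (hfJ : f ∈ vanishingIdeal) :
    weilConv f h ∈ vanishingIdeal := by
  rw [mem_vanishingIdeal] at hfJ ⊢
  obtain ⟨hf, h1, h2⟩ := hfJ
  rw [mulFourier_weilConv hf hh, mulFourier_weilConv hf hh, h1, h2, zero_mul, zero_mul]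
  exact ⟨hf.weilConv hh, rfl, rfl⟩

/-- RH-FREE. **Lemma 3.3 (i)**, linear part: `𝒥` is closed under sums (the two characters are linear).
[cite: ConnesConsani2021, Lemma 3.3 (i) §3 p. 12] -/
theorem add_mem_vanishingIdeal (hfJ : f ∈ vanishingIdeal) (hhJ : h ∈ vanishingIdeal) :
    f + h ∈ vanishingIdeal := by
  rw [mem_vanishingIdeal_iff_weilMellin] at hfJ hhJ ⊢
  obtain ⟨hf, hf1, hf0⟩ := hfJ
  obtain ⟨hh, hh1, hh0⟩ := hhJ
  rw [weilMellin_add hf.1.continuous hf.2 hh.1.continuous hh.2,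
    weilMellin_add hf.1.continuous hf.2 hh.1.continuous hh.2, hf1, hf0, hh1, hh0, add_zero]
  exact ⟨hf.add hh, rfl, rfl⟩

/-- RH-FREE. **Lemma 3.3 (i)**, linear part: `𝒥` is closed under scalars.
[cite: ConnesConsani2021, Lemma 3.3 (i) §3 p. 12] -/
theorem const_mul_mem_vanishingIdeal (c : ℂ) (hfJ : f ∈ vanishingIdeal) :
    (fun t ↦ c * f t) ∈ vanishingIdeal := by
  rw [mem_vanishingIdeal_iff_weilMellin] at hfJ ⊢
  obtain ⟨hf, hf1, hf0⟩ := hfJ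
  rw [weilMellin_const_mul, weilMellin_const_mul, hf1, hf0, mul_zero]
  exact ⟨hf.const_mul c, rfl, rfl⟩

/-- RH-FREE. **Lemma 3.3 (ii)** in the `𝒥`-spelling (tree: `isWeilTest_opQ`, `mulFourier_opQ_I_half`,
`mulFourier_opQ_neg_I_half`): `Q g ∈ 𝒥` for every test function `g`.
[cite: ConnesConsani2021, Lemma 3.3 (ii) §3 p. 12 (arXiv Lemma 14 (ii), p0012:L45)] -/
theorem opQ_mem_vanishingIdeal (hg : IsWeilTest g) : opQ g ∈ vanishingIdeal :=
  ⟨isWeilTest_opQ hg, mulFourier_opQ_I_half hg, mulFourier_opQ_neg_I_half hg⟩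

/-- RH-FREE. **Lemma 3.3 (iv)** (= arXiv Lemma 14 (iv), p0012:L50, proof L73): "Let `f` and `g` as in (iii)
[`Q(g) = f`], then `f` is positive definite if and only if `g` is positive definite" — "since the
Fourier transforms are related by the equality `(¼ + t²) ĝ(t) = f̂(t)`" (tree: `mulFourier_opQ`).
[cite: ConnesConsani2021, Lemma 3.3 (iv) §3 p. 12 (arXiv Lemma 14 (iv), p0012:L50, L73)] -/
theorem isPositiveDefinite_opQ_iff (hg : IsWeilTest g) :
    IsPositiveDefinite (opQ g) ↔ IsPositiveDefinite g := by
  have hq : ∀ t : ℝ, mulFourier (opQ g) t = ((1 / 4 + t ^ 2 : ℝ) : ℂ) * mulFourier g t := fun t ↦ by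
    rw [mulFourier_opQ hg]; push_cast; ring
  have hpos : ∀ t : ℝ, 0 < 1 / 4 + t ^ 2 := fun t ↦ by positivity
  simp only [IsPositiveDefinite, and_iff_right (integrable_of_isWeilTest hg),
    and_iff_right (integrable_of_isWeilTest (isWeilTest_opQ hg)), hq, Complex.re_ofReal_mul,
    Complex.im_ofReal_mul]
  refine forall_congr' fun t ↦ ⟨fun ⟨h1, h2⟩ ↦ ⟨?_, ?_⟩, fun ⟨h1, h2⟩ ↦ ⟨?_, ?_⟩⟩
  · exact (mul_nonneg_iff_of_pos_left (hpos t)).1 h1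
  · rcases mul_eq_zero.1 h2 with h | h
    · exact absurd h (hpos t).ne'
    · exact h
  · exact mul_nonneg (hpos t).le h1
  · rw [h2, mul_zero]

/-! ## Definition 3.4: positive functionals; Proposition 3.5 -/

/-- RH-FREE. **Connes–Consani 2021, Definition 3.4** (= arXiv Def. 15, p. 13, p0013:L1–L2): "Let
`E ⊂ C_c^∞(ℝ₊*)` be a subspace and `ψ` a linear form on `E`.  Then `ψ` is said to be *positive* if
`ψ(f) ≥ 0` for any positive definite `f ∈ E`."  Typed for a functional `ψ` on the additive avatars and
a subset `E` (CC: a subspace of test functions; the uses are `E = C_c^∞(I)` = `Yoshida1992.C a` and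
`E = C_c^∞(I) ∩ 𝒥`), comparing real parts as in the tree's `WeilPositivityOn` / `weilPropertyP`.  CC's
"`φ ≤ 0` on `E`" (Cor. 3.8) is `IsPositiveOn (-φ) E`.
[cite: ConnesConsani2021, Def. 3.4 §3 p. 13 (arXiv Def. 15, p0013:L1–L2)] -/
def IsPositiveOn (ψ : (ℝ → ℂ) → ℂ) (E : Set (ℝ → ℂ)) : Prop :=
  ∀ f ∈ E, IsPositiveDefinite f → 0 ≤ (ψ f).re

/-- RH-FREE. CC's "`φ ≤ 0` on `E`": `IsPositiveOn (-φ) E` unfolds to `Re φ(f) ≤ 0` for positive definite `f ∈ E`.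
[cite: ConnesConsani2021, Cor. 3.8 §3 p. 14; Def. 3.4 p. 13] -/
theorem isPositiveOn_neg_iff (φ : (ℝ → ℂ) → ℂ) (E : Set (ℝ → ℂ)) :
    IsPositiveOn (-φ) E ↔ ∀ f ∈ E, IsPositiveDefinite f → (φ f).re ≤ 0 := by
  simp only [IsPositiveOn, Pi.neg_apply, Complex.neg_re, neg_nonneg]

/-- RH-FREE. Positivity is inherited by smaller classes. [cite: ConnesConsani2021, Def. 3.4 §3 p. 13] -/
theorem IsPositiveOn.mono {ψ : (ℝ → ℂ) → ℂ} {E E' : Set (ℝ → ℂ)} (h : IsPositiveOn ψ E)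
    (hE : E' ⊆ E) : IsPositiveOn ψ E' :=
  fun f hf hpd ↦ h f (hE hf) hpd

/-- RH-FREE. **Connes–Consani 2021, Proposition 3.5** (= arXiv Prop. 16, p. 13, p0013:L6, proof L8–L9).  "Let
`ψ` be a functional on `C_c^∞(ℝ₊*)` and `I` a symmetric interval.  Then the restriction of `ψ` to
`C_c^∞(I) ∩ 𝒥` is positive if and only if the functional `ψ ∘ Q` is positive on
`C_c^∞(I) ⊂ C_c^∞(ℝ₊*)`."  (`I = [e^{−a}, e^{a}]`, `C_c^∞(I)` = `Yoshida1992.C a`.)  Proof as printed: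
(⇒) for positive definite `g ∈ C_c^∞(I)`, `Qg ∈ C_c^∞(I) ∩ 𝒥` is positive definite (Lemma 3.3 (ii),
(iv)); (⇐) for positive definite `f ∈ C_c^∞(I) ∩ 𝒥` take `g ∈ C_c^∞(I)` with `Qg = f` (Lemma 3.3
(iii), tree `exists_opQ_eq`), positive definite by (iv).  No linearity of `ψ` is used.
[cite: ConnesConsani2021, Prop. 3.5 §3 p. 13 (arXiv Prop. 16, p0013:L6–L9)] -/
theorem isPositiveOn_inter_vanishingIdeal_iff (ψ : (ℝ → ℂ) → ℂ) (a : ℝ) :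
    IsPositiveOn ψ (↑(Yoshida1992.C a) ∩ vanishingIdeal) ↔
      IsPositiveOn (fun g ↦ ψ (opQ g)) ↑(Yoshida1992.C a) := by
  constructor
  · intro h g hg hpd
    rw [SetLike.mem_coe, Yoshida1992.mem_C] at hg
    refine h (opQ g) ⟨?_, opQ_mem_vanishingIdeal hg.1⟩ ((isPositiveDefinite_opQ_iff hg.1).2 hpd)
    rw [SetLike.mem_coe, Yoshida1992.mem_C]
    exact ⟨isWeilTest_opQ hg.1, (tsupport_opQ_subset g).trans hg.2⟩
  · rintro h f ⟨hf, hfJ⟩ hpd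
    rw [SetLike.mem_coe, Yoshida1992.mem_C] at hf
    rw [mem_vanishingIdeal] at hfJ
    obtain ⟨g, hg, hgs, rfl⟩ := exists_opQ_eq hf.1 hf.2 hfJ.2.1 hfJ.2.2
    have hgC : g ∈ (Yoshida1992.C a : Set (ℝ → ℂ)) := by
      rw [SetLike.mem_coe, Yoshida1992.mem_C]; exact ⟨hg, hgs⟩
    exact h g hgC ((isPositiveDefinite_opQ_iff hg).1 hpd)

/-- RH-FREE. **The displayed implication (3.x) after Prop. 3.5** (p. 13, p0013:L18–L21), abstract form: "It
follows from Corollary 2.3 that the functional `L = D + W_∞` is positive on `C_c^∞(ℝ₊*)`.  One derives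
from Proposition 3.5 the following implication: `D∘Q ≤ 0` on `C_c^∞(I)` ⇒ `W_∞ ≥ 0` on
`C_c^∞(I) ∩ 𝒥`."  Here for any two functionals `φ` (CC's `D`) and `ψ` (CC's `W_∞ = archW`) with
`φ + ψ` positive on `C_c^∞(I)` (the input from Cor. 2.3, a hypothesis here) and `φ∘Q ≤ 0` on `C_c^∞(I)`:
then `ψ` is positive on `C_c^∞(I) ∩ 𝒥` (since `ψ(Qg) = (φ + ψ)(Qg) − φ(Qg) ≥ 0`, then Prop. 3.5 (⇐)).
[cite: ConnesConsani2021, §3 p. 13 display after Prop. 3.5 (p0013:L18–L21)] -/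
theorem isPositiveOn_inter_vanishingIdeal_of_add (φ ψ : (ℝ → ℂ) → ℂ) (a : ℝ)
    (hL : IsPositiveOn (fun f ↦ φ f + ψ f) ↑(Yoshida1992.C a))
    (hφ : IsPositiveOn (-fun g ↦ φ (opQ g)) ↑(Yoshida1992.C a)) :
    IsPositiveOn ψ (↑(Yoshida1992.C a) ∩ vanishingIdeal) := by
  rw [isPositiveOn_inter_vanishingIdeal_iff]
  rw [isPositiveOn_neg_iff] at hφ
  intro g hg hpd
  have hgC := hg
  rw [SetLike.mem_coe, Yoshida1992.mem_C] at hg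
  have hQ : opQ g ∈ (Yoshida1992.C a : Set (ℝ → ℂ)) := by
    rw [SetLike.mem_coe, Yoshida1992.mem_C]
    exact ⟨isWeilTest_opQ hg.1, (tsupport_opQ_subset g).trans hg.2⟩
  have h1 := hL (opQ g) hQ ((isPositiveDefinite_opQ_iff hg.1).2 hpd)
  have h2 := hφ g hgC hpd
  simp only [Complex.add_re] at h1
  linarith

/-! ## Corollary 3.8 and Remark 3.9 (i): the mechanism, generic in the even function -/

/-- RH-FREE. **The mechanism of Cor. 3.8 / Rem. 3.9 (i)** (p. 14, p0014:L15–L21 and L23–L32), generic in the even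
function `k(x) = G(|x|)` (`G ∈ C²`, `G′(0) = k′(0⁺) = 1`, as for CC's `δ`: `δ(ν(x)) = δ(1) + |x| + O(x²)`,
p. 13) and in a pointwise majorant `M`: if every positive definite `f ∈ C_c^∞([−s, s])` obeys
`|f(x) + f(−x)| ≤ 2 f(0) M(x)` on `(0, s]` (Cor. 3.8: `M = 1` from `|f(x)| ≤ f(0)`; Rem. 3.9 (i):
`M(x) = cos(π/(⌈s/x⌉ + 1))` from [BK] Thm 2) and `∫₀ˢ ‖Q₊k‖ M ≤ 1`, then by (Qprime)
`D₊(Q₊f) = −2f(0) + ∫₀^∞ (f(x) + f(−x)) Q₊k(x) dx ≤ −2f(0) + 2f(0) = 0`, i.e. `D₊∘Q₊ ≤ 0` on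
`C_c^∞([−s, s])` (`D₊ = evenFunctional G`, (Qprime) = tree `evenFunctional_opQ`).
[cite: ConnesConsani2021, Cor. 3.8 §3 p. 14 (proof, arXiv Cor. 19, p0014:L15–L21); Rem. 3.9 (i) (p0014:L23–L32)] -/
theorem isPositiveOn_neg_evenFunctional_opQ_of_majorant {G : ℝ → ℂ} (hG : ContDiff ℝ 2 G)
    (hG1 : deriv G 0 = 1) {s : ℝ} {M : ℝ → ℝ}
    (hMi : IntegrableOn (fun x ↦ ‖opQ G x‖ * M x) (Ioc 0 s))
    (hM : ∀ f ∈ (Yoshida1992.C s : Set (ℝ → ℂ)), IsPositiveDefinite f →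
      ∀ x ∈ Ioc 0 s, ‖f x + f (-x)‖ ≤ 2 * (f 0).re * M x)
    (hnum : ∫ x in Ioc 0 s, ‖opQ G x‖ * M x ≤ 1) :
    IsPositiveOn (-fun f ↦ evenFunctional G (opQ f)) ↑(Yoshida1992.C s) := by
  rw [isPositiveOn_neg_iff]
  intro f hfC hpd
  have hfC' := hfC
  rw [SetLike.mem_coe, Yoshida1992.mem_C] at hfC
  obtain ⟨hf, hfs⟩ := hfC
  have h0 := (hpd.apply_zero_nonneg hf).1
  rw [evenFunctional_opQ (contDiff_two_of_isWeilTest' hf) hf.2 hG, hG1, Complex.add_re]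
  -- the boundary term `−2 f(0)`
  have hb : (-2 * (1 : ℂ) * f 0).re = -2 * (f 0).re := by simp
  rw [hb]
  -- the integral term is at most `2 f(0) ∫₀ˢ ‖Q₊k‖ M ≤ 2 f(0)`
  set J := ∫ x in Ioi (0 : ℝ), (f x + f (-x)) * opQ G x with hJ
  have hsupp : ∀ x, s < |x| → f x = 0 := fun x hx ↦
    image_eq_zero_of_notMem_tsupport fun hx' ↦ by
      have := hfs hx'
      rw [mem_Icc, ← abs_le] at this
      linarith
  have hcont : Continuous fun x ↦ (f x + f (-x)) * opQ G x :=
    ((hf.1.continuous).add (hf.1.continuous.comp continuous_neg)).mul (continuous_opQ' hG)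
  have hcs : HasCompactSupport fun x ↦ (f x + f (-x)) * opQ G x :=
    (hf.2.add (hf.2.comp_homeomorph (Homeomorph.neg ℝ))).mul_right
  have hint : IntegrableOn (fun x ↦ ‖(f x + f (-x)) * opQ G x‖) (Ioi 0) :=
    (hcont.integrable_of_hasCompactSupport hcs).norm.integrableOn
  have hMi' : IntegrableOn (fun x ↦ 2 * (f 0).re * (‖opQ G x‖ * M x)) (Ioc 0 s) :=
    hMi.const_mul _
  have hdom : IntegrableOn ((Ioc 0 s).indicator fun x ↦ 2 * (f 0).re * (‖opQ G x‖ * M x)) (Ioi 0) :=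
    (hMi'.integrable_indicator measurableSet_Ioc).integrableOn
  have hle : J.re ≤ 2 * (f 0).re * ∫ x in Ioc 0 s, ‖opQ G x‖ * M x := by
    calc J.re ≤ ‖J‖ := Complex.re_le_norm J
      _ ≤ ∫ x in Ioi (0 : ℝ), ‖(f x + f (-x)) * opQ G x‖ := norm_integral_le_integral_norm _
      _ ≤ ∫ x in Ioi (0 : ℝ), (Ioc 0 s).indicator (fun x ↦ 2 * (f 0).re * (‖opQ G x‖ * M x)) x := by
          refine setIntegral_mono_on hint hdom measurableSet_Ioi fun x hx ↦ ?_
          by_cases hxs : x ≤ s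
          · have hxm : x ∈ Ioc 0 s := ⟨hx, hxs⟩
            rw [indicator_of_mem hxm, norm_mul]
            have := hM f hfC' hpd x hxm
            nlinarith [norm_nonneg (opQ G x), norm_nonneg (f x + f (-x))]
          · have hxs : s < x := lt_of_not_ge hxs
            have hx1 : f x = 0 := hsupp x (by rw [abs_of_pos hx]; exact hxs)
            have hx2 : f (-x) = 0 := hsupp (-x) (by rw [abs_neg, abs_of_pos hx]; exact hxs)
            rw [hx1, hx2, zero_add, zero_mul, norm_zero]
            exact indicator_nonneg (fun y hy ↦ by
              have := hM f hfC' hpd y hy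
              nlinarith [norm_nonneg (opQ G y), norm_nonneg (f y + f (-y))]) x
      _ = 2 * (f 0).re * ∫ x in Ioc 0 s, ‖opQ G x‖ * M x := by
          rw [setIntegral_indicator measurableSet_Ioc,
            inter_eq_right.2 (Ioc_subset_Ioi_self : Ioc (0 : ℝ) s ⊆ Ioi 0), integral_const_mul]
  have : 2 * (f 0).re * ∫ x in Ioc 0 s, ‖opQ G x‖ * M x ≤ 2 * (f 0).re * 1 :=
    mul_le_mul_of_nonneg_left hnum (by positivity)
  linarith

/-- RH-FREE. **Cor. 3.8's mechanism** (p0014:L15–L21): with `|f(x)| ≤ f(0)` (`IsPositiveDefinite.norm_le`), if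
`∫₀ˢ ‖Q₊k(x)‖ dx ≤ 1` then `D₊∘Q₊ ≤ 0` on `C_c^∞([−s, s])`, for any even `k = G ∘ |·|`, `G ∈ C²`,
`G′(0) = 1` (CC: `k(x) = δ(ν(x))`; printed condition "`∫₀ˢ Q₊δ(ν(x)) dx ≤ 1`", the integrand being
positive there). [cite: ConnesConsani2021, Cor. 3.8 §3 p. 14 (proof, arXiv Cor. 19, p0014:L15–L21)] -/
theorem isPositiveOn_neg_evenFunctional_opQ {G : ℝ → ℂ} (hG : ContDiff ℝ 2 G) (hG1 : deriv G 0 = 1)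
    {s : ℝ} (hnum : ∫ x in Ioc 0 s, ‖opQ G x‖ ≤ 1) :
    IsPositiveOn (-fun f ↦ evenFunctional G (opQ f)) ↑(Yoshida1992.C s) := by
  have hMi : IntegrableOn (fun x ↦ ‖opQ G x‖ * (1 : ℝ)) (Ioc 0 s) := by
    simp only [mul_one]
    exact ((continuous_opQ' hG).norm.integrableOn_Icc (a := 0) (b := s)).mono_set Ioc_subset_Icc_self
  refine isPositiveOn_neg_evenFunctional_opQ_of_majorant hG hG1 hMi (fun f hfC hpd x _ ↦ ?_)
    (by simpa using hnum)
  rw [SetLike.mem_coe, Yoshida1992.mem_C] at hfC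
  calc ‖f x + f (-x)‖ ≤ ‖f x‖ + ‖f (-x)‖ := norm_add_le _ _
    _ ≤ (f 0).re + (f 0).re := add_le_add (hpd.norm_le hfC.1 x) (hpd.norm_le hfC.1 (-x))
    _ = 2 * (f 0).re * 1 := by ring

/-- RH-FREE. **Connes–Consani 2021, Corollary 3.8** (= arXiv Cor. 19, p. 14, p0014:L13–L21) — NUMERICAL-IN-PRINT.
"One has `D∘Q ≤ 0` on `C_c^∞(I)`, where `I = [u⁻¹, u]`, `u = 1.10246`.  Proof. … One verifies
numerically that [`∫₀ˢ Q₊δ(ν(x)) dx ≤ 1`] holds for `s = 0.097542`, which gives `eˢ ≃ u`."  Typed as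
printed modulo the §2 object `δ`: for the even function `k = G ∘ |·|` (`G(x) = δ(eˣ)` on `x ≥ 0`,
`G ∈ C²`, `G′(0) = δ′(1⁺) = 1`) and WITH THE NUMERICAL VERIFICATION AS HYPOTHESIS `hnum` (floating point
in print, no interval arithmetic claimed; not re-computed here), `D₊∘Q₊ ≤ 0` on
`C_c^∞([−s, s]) = C_c^∞([u⁻¹, u])`, `s = 0.097542 = log u`.  Not on the path to Thm. 1; superseded in
range by `isPositiveOn_archW_inter_vanishingIdeal` (every `u ≤ 2`) for its consequence `W_∞ ≥ 0`.
[cite: ConnesConsani2021, Cor. 3.8 §3 p. 14 (arXiv Cor. 19, p0014:L13–L21)] -/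
theorem cor_3_8_of_numericalInput {G : ℝ → ℂ} (hG : ContDiff ℝ 2 G) (hG1 : deriv G 0 = 1)
    (hnum : ∫ x in Ioc 0 (0.097542 : ℝ), ‖opQ G x‖ ≤ 1) :
    IsPositiveOn (-fun f ↦ evenFunctional G (opQ f)) ↑(Yoshida1992.C (0.097542 : ℝ)) :=
  isPositiveOn_neg_evenFunctional_opQ hG hG1 hnum

/-- RH-FREE. **Connes–Consani 2021, Remark 3.9 (i)** (= arXiv Rem. 20 (i), p. 14, p0014:L23–L32) —
NUMERICAL-IN-PRINT.  "One can improve the constant `u` of Corollary 3.8 using the bound given by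
Theorem 2 of [BK] [typo corrected in [BKe]: ceiling function] `|f(x)| ≤ f(0) cos(π/(⌈s/x⌉ + 1))` for any
positive definite function `f` with support in the interval `[−s, s]`.  The condition on `s` now becomes
`∫₀ˢ Q₊δ(ν(x)) cos(π/(⌈s/x⌉ + 1)) dx ≤ 1`.  This holds for `s = 0.14043` and improves the value of `u`
of Corollary 3.8 to `1.15077`."  Typed with BOTH printed inputs as hypotheses: the Boas–Kac pointwise
bound `hBK` (R. P. Boas, M. Kac, Duke Math. J. 12 (1945) 189–206, Thm 2; restated as Kolountzakis–Révész,
Canad. J. Math. 58 (2006) 401–418, Cor. 1 — an input, not a tree fact) and the numerical verification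
`hnum` at `s = 0.14043` (floating point in print).
[cite: ConnesConsani2021, Rem. 3.9 (i) §3 p. 14 (arXiv Rem. 20 (i), p0014:L23–L32)] -/
theorem rem_3_9_i_of_numericalInput {G : ℝ → ℂ} (hG : ContDiff ℝ 2 G) (hG1 : deriv G 0 = 1)
    (hBK : ∀ f ∈ (Yoshida1992.C (0.14043 : ℝ) : Set (ℝ → ℂ)), IsPositiveDefinite f →
      ∀ x : ℝ, x ≠ 0 → ‖f x‖ ≤ (f 0).re * Real.cos (π / (⌈(0.14043 : ℝ) / |x|⌉₊ + 1)))
    (hMi : IntegrableOn (fun x ↦ ‖opQ G x‖ * Real.cos (π / (⌈(0.14043 : ℝ) / |x|⌉₊ + 1)))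
      (Ioc 0 (0.14043 : ℝ)))
    (hnum : ∫ x in Ioc 0 (0.14043 : ℝ),
      ‖opQ G x‖ * Real.cos (π / (⌈(0.14043 : ℝ) / |x|⌉₊ + 1)) ≤ 1) :
    IsPositiveOn (-fun f ↦ evenFunctional G (opQ f)) ↑(Yoshida1992.C (0.14043 : ℝ)) := by
  refine isPositiveOn_neg_evenFunctional_opQ_of_majorant hG hG1 hMi (fun f hfC hpd x hx ↦ ?_) hnum
  have h1 := hBK f hfC hpd x hx.1.ne'
  have h2 := hBK f hfC hpd (-x) (neg_ne_zero.2 hx.1.ne')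
  rw [abs_neg] at h2
  calc ‖f x + f (-x)‖ ≤ ‖f x‖ + ‖f (-x)‖ := norm_add_le _ _
    _ ≤ _ := add_le_add h1 h2
    _ = 2 * (f 0).re * Real.cos (π / (⌈(0.14043 : ℝ) / |x|⌉₊ + 1)) := by ring

/-! ## The consequence `W_∞ ≥ 0 on C_c^∞(I) ∩ 𝒥`, superseded in range by the tree -/

/-- RH-FREE. **`W_∞ ≥ 0` on `C_c^∞(I) ∩ 𝒥` for every symmetric `I = [e^{−c}, e^{c}] ⊆ [2⁻¹, 2]`** — the
conclusion CC draw from Cor. 3.8 / Rem. 3.9 (i) via (3.x) for `u = 1.10246`, `1.15077` (p. 13 L18–L22,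
p. 14), PROVED for all `0 < c ≤ log 2` from the tree: a positive definite `f ∈ C_c^∞(I) ∩ 𝒥` is
`g ∗ g*` with `supp g ⊆ [−c/2, c/2]` (Prop. 3.2), the explicit-formula functional `W(f)` has vanishing
polar part on `𝒥` and vanishing prime part below `log 2` (`weilPrimeTerm_eq_zero_of_tsupport_subset`), so
`W_∞(f) = W(f) = W(g ∗ g*) ≥ 0` by Yoshida's `WeilPositivityOn ((log 2)/2)`
(`weilPositivityOn_of_le_log_two_half`).  `W_∞ = archW = weilArchTermBombieri`
(`ArchimedeanSoninTrace.lean`).  RH-FREE.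
[cite: ConnesConsani2021, §3 p. 13 display (3.x) (p0013:L18–L22) and Cor. 3.8 p. 14; Yoshida1992 Thm. 1] -/
theorem isPositiveOn_archW_inter_vanishingIdeal {c : ℝ} (hc : 0 < c) (hc2 : c ≤ Real.log 2) :
    IsPositiveOn archW (↑(Yoshida1992.C c) ∩ vanishingIdeal) := by
  rintro f ⟨hfC, hfJ⟩ hpd
  rw [SetLike.mem_coe, Yoshida1992.mem_C] at hfC
  obtain ⟨hf, hfs⟩ := hfC
  rw [mem_vanishingIdeal_iff_weilMellin] at hfJ
  obtain ⟨g, hg, hgs, rfl⟩ := (isPositiveDefinite_iff_exists_weilConv_weilReflect hc hf hfs).1 hpd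
  -- `W(g ∗ g*) ≥ 0` by Weil positivity on the window `c/2 ≤ (log 2)/2`
  have hpos : 0 ≤ (weilQuadratic g).re :=
    weilPositivityOn_of_le_log_two_half (by linarith) g hg hgs
  -- `W = polar − prime + arch`, polar = 0 on `𝒥`, prime = 0 below `log 2`, arch = `W_∞`
  have hprime : weilPrimeTerm (weilConv g (weilReflect g)) = 0 :=
    weilPrimeTerm_eq_zero_of_tsupport_subset hf.1.continuous
      (hfs.trans (Icc_subset_Icc (by linarith) hc2))
  have hpolar : weilPolarTerm (weilConv g (weilReflect g)) = 0 := by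
    rw [weilPolarTerm, hfJ.2.1, hfJ.2.2, add_zero]
  have hW : weilQuadratic g = archW (weilConv g (weilReflect g)) := by
    rw [weilQuadratic, weilFunctional, hpolar, hprime, archW,
      weilArchTermBombieri_eq_weilArchTerm_holds hf]
    ring
  rwa [hW] at hpos

/-- RH-FREE. The printed instance of Cor. 3.8's consequence: `W_∞ ≥ 0` on `C_c^∞([u⁻¹, u]) ∩ 𝒥`, `u = 1.10246`
(`log u ≤ log 2`), from the tree (no numerical input). [cite: ConnesConsani2021, Cor. 3.8 §3 p. 14 with display (3.x) p. 13] -/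
theorem isPositiveOn_archW_inter_vanishingIdeal_printed :
    IsPositiveOn archW (↑(Yoshida1992.C (Real.log 1.10246)) ∩ vanishingIdeal) :=
  isPositiveOn_archW_inter_vanishingIdeal (Real.log_pos (by norm_num))
    (Real.log_le_log (by norm_num) (by norm_num))

/-! ## Dictionary: Def. 3.4-positivity of `W` and Connes's `P(n)` -/

/-- RH-FREE. **Dictionary.**  Def. 3.4-positivity of the explicit-formula functional `W` (`weilFunctional`) on
`C_c^∞([n⁻¹, n]) ∩ 𝒥` implies Connes's property `P(n)` (`weilPropertyP n`: `W(g ∗ g*) ≥ 0` for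
`supp g ⊆ [n^{−1/2}, n^{1/2}]`, `ĝ(± i/2) = 0`): `f = g ∗ g*` is positive definite (Prop. 3.2), lies in
`C_c^∞([n⁻¹, n])` and in `𝒥` (Lemma 3.3 (i)).  (The converse is not claimed: `f ∈ 𝒥` only forces
`ĝ(i/2)·conj ĝ(−i/2) = 0`.)  RH-FREE implication between two window statements.
[cite: ConnesConsani2021, Def. 3.4 §3 p. 13; Connes2026Letter §4.1 p. 17 (P(n))] -/
theorem weilPropertyP_of_isPositiveOn_weilFunctional {n : ℕ}
    (h : IsPositiveOn weilFunctional (↑(Yoshida1992.C (Real.log n)) ∩ vanishingIdeal)) :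
    weilPropertyP n := by
  intro g hg hgs h1 h0
  have hf : IsWeilTest (weilConv g (weilReflect g)) := hg.weilConv hg.weilReflect
  refine h _ ⟨?_, ?_⟩ (isPositiveDefinite_weilConv_weilReflect hg)
  · rw [SetLike.mem_coe, Yoshida1992.mem_C]
    refine ⟨hf, (tsupport_weilConv_weilReflect_subset hg.2 hgs).trans (le_of_eq ?_)⟩
    congr 1 <;> ring
  · exact weilConv_mem_vanishingIdeal_right hg.weilReflect ⟨hg, h1, h0⟩

/-- RH-FREE. Instance `n = 3` of the dictionary's hypothesis from the tree's kernel certificate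
`weilPositivityOn_log_three_half` (Weil positivity for `supp g ⊆ [3^{−1/2}, 3^{1/2}]`, no vanishing
condition, hence on the whole of `C_c^∞([3⁻¹, 3])`'s hermitian squares): `W` is Def. 3.4-positive on
`C_c^∞([3⁻¹, 3]) ∩ 𝒥` — the range `[3⁻¹, 3] ⊋ [u⁻¹, u]`, `u = 1.10246`, is the lead's "superseded in
range" remark (for the FULL functional `W`, primes `2` included). RH-FREE.
[cite: ConnesConsani2021, Def. 3.4 §3 p. 13; Yoshida1992 Thm. 1 p. 310 ((log 3)/2 rung)] -/
theorem isPositiveOn_weilFunctional_log_three :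
    IsPositiveOn weilFunctional (↑(Yoshida1992.C (Real.log 3)) ∩ vanishingIdeal) := by
  rintro f ⟨hfC, -⟩ hpd
  rw [SetLike.mem_coe, Yoshida1992.mem_C] at hfC
  obtain ⟨hf, hfs⟩ := hfC
  obtain ⟨g, hg, hgs, rfl⟩ :=
    (isPositiveDefinite_iff_exists_weilConv_weilReflect (Real.log_pos (by norm_num)) hf hfs).1 hpd
  exact weilPositivityOn_log_three_half g hg hgs


/-! ## Lemma 3.3 (iii) for an arbitrary interval, and "`𝒥` is the range of `Q`" -/

/-- `Q` commutes with translations: `Q(g(· − m)) = (Qg)(· − m)`. [cite: ConnesConsani2021, Lemma 3.3 (ii) §3 p. 12] -/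
theorem opQ_weilTranslate (g : ℝ → ℂ) (m : ℝ) :
    opQ (weilTranslate g m) = weilTranslate (opQ g) m := by
  have e : weilTranslate g m = fun t ↦ g (t - m) := rfl
  have h1 : deriv (fun t ↦ g (t - m)) = fun t ↦ deriv g (t - m) := by
    funext t; exact deriv_comp_sub_const g m t
  have h2 : deriv (fun t ↦ deriv g (t - m)) = fun t ↦ deriv (deriv g) (t - m) := by
    funext t; exact deriv_comp_sub_const (deriv g) m t
  funext t
  rw [e, opQ_apply, h1, h2]
  rfl

/-- Support of a translate: `tsupport g ⊆ [c, d]` gives `tsupport g(· − m) ⊆ [c + m, d + m]`. [folklore] -/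
private theorem tsupport_weilTranslate_subset {g : ℝ → ℂ} {c d : ℝ} (h : tsupport g ⊆ Icc c d) (m : ℝ) :
    tsupport (weilTranslate g m) ⊆ Icc (c + m) (d + m) := by
  have e : weilTranslate g m = fun t ↦ g (t + -m) := by
    funext t; simp [weilTranslate, sub_eq_add_neg]
  rw [e]
  refine (tsupport_translate_subset h (-m)).trans (le_of_eq ?_)
  congr 1 <;> ring

/-- RH-FREE. **Connes–Consani 2021, Lemma 3.3 (iii) for an arbitrary compact interval** (= arXiv Lemma 14
(iii), p. 12, p0012:L46–L49, as printed: "Let `f ∈ C_c^∞(ℝ₊*)` with support in an interval `I`, fulfill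
the vanishing conditions (3.2).  Then there exists `g ∈ C_c^∞(ℝ₊*)` with support in `I` and such that
`Q(g) = f`").  The tree's `exists_opQ_eq` is the symmetric window `I = [e^{−a}, e^{a}]`; this removes its
`TODO(general form)`: conjugate by the translation to the midpoint (`Q` commutes with translations,
`opQ_weilTranslate`; the vanishing conditions are translation invariant because translation multiplies
`f̂(s)` by `e^{(s−½)x} ≠ 0`, `weilMellin_weilTranslate`).
[cite: ConnesConsani2021, Lemma 3.3 (iii) §3 p. 12 (arXiv Lemma 14 (iii), p0012:L46–L49)] -/
theorem exists_opQ_eq_of_tsupport_subset_Icc {α β : ℝ} (hf : IsWeilTest f)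
    (hfs : tsupport f ⊆ Icc α β) (h1 : mulFourier f (I / 2) = 0) (h2 : mulFourier f (-(I / 2)) = 0) :
    ∃ g : ℝ → ℂ, IsWeilTest g ∧ tsupport g ⊆ Icc α β ∧ opQ g = f := by
  -- translate to the symmetric window `[−a, a]`, `a = (β − α)/2`, `m = (α + β)/2`
  set m : ℝ := (α + β) / 2 with hm
  set f₀ : ℝ → ℂ := weilTranslate f (-m) with hf₀
  have hf₀t : IsWeilTest f₀ := hf.weilTranslate (-m)
  have hf₀s : tsupport f₀ ⊆ Icc (-((β - α) / 2)) ((β - α) / 2) := by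
    refine (tsupport_weilTranslate_subset hfs (-m)).trans (le_of_eq ?_)
    rw [hm]; congr 1 <;> ring
  have hf₀1 : mulFourier f₀ (I / 2) = 0 := by
    rw [mulFourier_I_half] at h1 ⊢
    rw [hf₀, weilMellin_weilTranslate, h1, mul_zero]
  have hf₀2 : mulFourier f₀ (-(I / 2)) = 0 := by
    rw [mulFourier_neg_I_half] at h2 ⊢
    rw [hf₀, weilMellin_weilTranslate, h2, mul_zero]
  obtain ⟨g₀, hg₀, hg₀s, hg₀Q⟩ := exists_opQ_eq hf₀t hf₀s hf₀1 hf₀2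
  refine ⟨weilTranslate g₀ m, hg₀.weilTranslate m, ?_, ?_⟩
  · refine (tsupport_weilTranslate_subset hg₀s m).trans (le_of_eq ?_)
    rw [hm]; congr 1 <;> ring
  · rw [opQ_weilTranslate, hg₀Q, hf₀]
    funext t
    simp [weilTranslate]

/-- RH-FREE. **"The ideal `𝒥` defined by the vanishing condition (3.2) is the range of a second order
differential operator"** (p. 12, p0012:L42, the sentence introducing Lemma 3.3): `𝒥 = Q(C_c^∞(ℝ₊*))`
— Lemma 3.3 (ii) gives `⊇`, Lemma 3.3 (iii) (arbitrary interval) gives `⊆`.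
[cite: ConnesConsani2021, §3 p. 12 (p0012:L42) with Lemma 3.3 (ii), (iii)] -/
theorem vanishingIdeal_eq_image_opQ : vanishingIdeal = opQ '' {g | IsWeilTest g} := by
  ext f
  constructor
  · rintro ⟨hf, h1, h2⟩
    obtain ⟨R, hR⟩ := hf.2.isCompact.isBounded.subset_closedBall 0
    have hfs : tsupport f ⊆ Icc (-R) R := by
      intro t ht
      have := hR ht
      rw [Metric.mem_closedBall, dist_zero_right, Real.norm_eq_abs, abs_le] at this
      exact this
    obtain ⟨g, hg, -, hgQ⟩ := exists_opQ_eq_of_tsupport_subset_Icc hf hfs h1 h2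
    exact ⟨g, hg, hgQ⟩
  · rintro ⟨g, hg, rfl⟩
    exact opQ_mem_vanishingIdeal hg

/-- RH-FREE. **Lemma 3.3 (ii)+(iii) with supports**: `𝒥 ∩ C_c^∞(I) = Q(C_c^∞(I))` for every compact
interval `I = [e^{α}, e^{β}]` ("its support is contained in the support of `g`" / "with support in `I`").
[cite: ConnesConsani2021, Lemma 3.3 (ii)–(iii) §3 p. 12 (arXiv Lemma 14, p0012:L44–L49)] -/
theorem vanishingIdeal_inter_eq_image_opQ (α β : ℝ) :
    vanishingIdeal ∩ {f | tsupport f ⊆ Icc α β} =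
      opQ '' {g | IsWeilTest g ∧ tsupport g ⊆ Icc α β} := by
  ext f
  constructor
  · rintro ⟨⟨hf, h1, h2⟩, hfs⟩
    obtain ⟨g, hg, hgs, hgQ⟩ := exists_opQ_eq_of_tsupport_subset_Icc hf hfs h1 h2
    exact ⟨g, ⟨hg, hgs⟩, hgQ⟩
  · rintro ⟨g, ⟨hg, hgs⟩, rfl⟩
    exact ⟨opQ_mem_vanishingIdeal hg, (tsupport_opQ_subset g).trans hgs⟩

end Literature.NumberTheory.ConnesConsani2021

end
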